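import Mathlib
import HarnessLib
import Literature.Analysis.Fourier.AiryHardyTails
import Literature.NumberTheory.LFunctions.CubicSumGauss
import Literature.NumberTheory.LFunctions.TrapezoidPoisson

/-!
# The twisted incomplete cubic Gauss sum as Gauss sums times Airy–Hardy integrals
# (the structure behind Graham–Kolesnik's Lemma 7.16, with a shift and a real linear twist) — PROVED

Topic `Literature/NumberTheory/LFunctions`. Graham–Kolesnik, *Van der Corput's Method of Exponential
Sums* (LMS LN 126, CUP 1991), Lemma 7.16, evaluates the "incomplete perturbed Gauss sum"
`S(μ; a, b; c) = ∑_{N<n≤N₁} e(μn³ + (an² + bn)/c)` (`(a, c) = 1`, `c ≤ N ≤ N₁ ≤ 2N`, `0 < μ ≤ N⁻²`).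
Its proof (p. 66) has two halves: (i) the STRUCTURE step — insert the trapezoid weight `g`
(`+ O(1)`), split `n` into residue classes modulo `c`, apply Poisson summation, obtaining
`S = c⁻¹ ∑_h G(a, b+h; c) ∫ g(x) e(μx³ - hx/c) dx + O(1)`, and discard all `h` outside the
near-stationary window by Lemmas 7.8–7.9 ("the terms with `|h| ≥ 16c` contribute `≪ c^{1/2}` … the
terms with `1 ≤ |h| < 16c` and `h ∉ [2μcN², 4μcN₁²]` contribute `≪ c^{1/2} log N` … the term with
`h = 0` contributes `≪ μ⁻¹N⁻²`"); (ii) the EVALUATION of the remaining integrals by the Airy–Hardy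
Lemma 7.7.

This file PROVES half (i) in the generality needed for the Huxley–Watt minor arcs of Bourgain's
Theorem 4 (`Literature.NumberTheory.LFunctions.Bourgain2017_theorem4_log`, J. AMS 30 (2017) §4):
there the quadratic coefficient is `a/q + β` with `|β| ≲ 1/R²` NOT of Dirichlet quality, which one
removes by completing the cube, `μn³ + βn² = μ(n+s)³ - 3μs²n - μs³`, at the price of a SHIFT `s`
inside the cube and a REAL linear coefficient, written `(b + qλ)/q` with `b ∈ ℤ`, `|qλ| ≤ 1/2`. So we
treat

`S = ∑_{N<n≤N₁} e(μ(n+s)³ + λn) · e((an² + bn)/q)`     (`cubicSum q a b μ s λ N N₁`)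

and prove (`cubicSum_structure`): for `q ≥ 1`, `(a, q) = 1`, `μ > 0`, `1 ≤ N`, `N + 1 ≤ N₁`, and,
with `N' = N + s`, `N₁' = N₁ + s`, `1 ≤ N'`, `N₁' ≤ 2N'`, `μN'² ≤ 1`, `|qλ| ≤ 1/2`,

`‖S - q⁻¹ ∑_{h ∈ W} G(a, b+h; q) e(ω_h s) J(μ, q; N', N₁'; h - qλ)‖ ≤ 2 + 11/(μN'²) + 227 q^{1/2}(1 + log q)`,

where `ω_h = (h - qλ)/q`, `J(μ, c; P, P₁; h) = ∫_P^{P₁+1} g(y) e(μy³ - (h/c)y) dy` is the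
trapezoid-weighted Airy–Hardy integral of Lemmas 7.8–7.9 (`airyTrap`), and
`W = {h ∈ ℤ : 2μqN'² < h - qλ < 4μq(N₁'+1)²}` (`window`, a set of at most `34μqN'² + 1` integers in
`[0, 36q]`). For `s = λ = 0` this is exactly the decomposition of G–K's proof with the window left
unevaluated (half (ii), the Airy–Hardy evaluation with `Literature.Analysis.Fourier.AiryHardy.GrahamKolesnik_lemma77`,
is the business of the user, who knows whether `μqN'² ≳ 1`).

## Proof (Graham–Kolesnik p. 66, made quantitative)

1. `‖S - S_g‖ ≤ 2` (`norm_cubicSum_sub_cubicTrapSum_le`), `S_g` the `g`-weighted sum over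
   `N < n ≤ N₁ + 1`.
2. `S_g = q⁻¹ ∑_{k mod q} G(a, b-k; q) I_k`, `I_k = ∑_n g(n) e(μ(n+s)³ + λn + kn/q)`
   (`cubicTrapSum_eq_sum_gauss`, from `CubicSum.sum_quadPhase_mul_eq` of `CubicSumGauss.lean`).
3. Truncated Poisson summation of each `I_k` (`CubicSum.trap_expansion` of `TrapezoidPoisson.lean`,
   `|θ'| ≤ 3μ(N₁'+1)² + 2`): `‖I_k - ∑_{ν=-V}^{V} A(k̃ + νq)‖ ≤ (1 + 2πT)(N₁ - N + 7)η_V`,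
   `A(h') = ∫ g(x) e(μ(x+s)³ + λx + h'x/q) dx` (`norm_innerSum_sub_le`); the bijection
   `(k, ν) ↦ k̃ + νq` (`sum_zmod_sum_Icc_eq_sum_Ico`) and `h = -h'` give
   `‖S_g - q⁻¹ ∑_{-Vq-q<h≤Vq} G(a, b+h; q) A(-h)‖ ≤ (2q)^{1/2}(1 + 2πT)(N₁ - N + 7) η_V → 0`
   (`norm_cubicTrapSum_sub_sum_poissonInt_le`, using `|G| ≤ (2q)^{1/2}`,
   `CubicSum.norm_quadGaussSum_le_sqrt`).
4. `A(-h) = e(ω_h s) J(μ, q; N', N₁'; h - qλ)` by `y = x + s` (`poissonInt_neg`).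
5. For `h ∉ W` (Lemma 7.8, `GrahamKolesnik_lemma78`): `‖A(-h)‖ ≤ 7q/(μqN'² + |h - qλ|)`; for
   `|h| > 37q` (Lemma 7.9, `GrahamKolesnik_lemma79`): `‖A(-h)‖ ≤ 200q²/(h - qλ)²`; hence
   `‖A(-h)‖ ≤ β(h)` (`tailBound`: `7/(μN'²)` at `h = 0`, `14q/|h|` for `|h| ≤ 37q`,
   `200q²/((|h|-1)|h|)` beyond) and `∑_{|h| ≤ L} β(h) ≤ 7/(μN'²) + 28q(5 + log q) + 11q` uniformly in
   `L` (`sum_tailBound_le`: harmonic sum and telescoping).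
6. For `V ≥ 38` the window lies inside `(-Vq-q, Vq]`, so
   `‖S - MT‖ ≤ 2 + (2q)^{1/2} C_T η_V + (2/q)^{1/2}(7/(μN'²) + 28q(5 + log q) + 11q)`; let `V → ∞`
   (`AFE.exists_sawEta_le`) and simplify the constants (`√2 ≤ 3/2`, `log 37 ≤ 4`).

## Main definitions and results (namespace `Literature.NumberTheory.LFunctions.CubicSum`)

* `cubicSum`, `cubicTrapSum`, `innerSum`, `poissonInt`, `airyTrap`, `window`, `tailBound` — DEFINITIONS.
* `cubicSum_structure` — the theorem above. All the numbered steps are separate lemmas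
  (`norm_cubicSum_sub_cubicTrapSum_le`, `cubicTrapSum_eq_sum_gauss`, `norm_innerSum_sub_le`,
  `sum_Icc_neg_eq`, `sum_zmod_sum_Icc_eq_sum_Ico`, `sum_Ico_eq_sum_Ioc_neg`,
  `norm_cubicTrapSum_sub_sum_poissonInt_le`, `poissonInt_neg`, `not_mem_window`,
  `mem_window_bounds`, `norm_poissonInt_neg_le_of_not_window`, `norm_poissonInt_neg_le_of_far`,
  `norm_poissonInt_neg_le_tailBound`, `sum_tailBound_le`), plus elementary tools (`norm_summand`,
  `stdAddChar_mul_natCast`, `trap_add`, `sum_Icc_inv_le_log`,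
  `sum_Icc_inv_mul_eq`, `sum_Icc_inv_mul_le`, `log_37_le`).

Everything is PROVED; no named fact is introduced.

## References

* S. W. Graham, G. Kolesnik, *Van der Corput's Method of Exponential Sums*, LMS Lecture Note Series
  126, Cambridge Univ. Press 1991 — Lemma 7.16 and its proof (pp. 65–66), Lemmas 7.7–7.9.
  [GrahamKolesnik1991]
* J. Bourgain, *Decoupling, exponential sums and the Riemann zeta function*, J. Amer. Math. Soc. 30
  (2017), 205–224 — §4 (the Huxley–Watt minor arcs, where the shifted/twisted form is used).
  [BourgainJAMS2017]
* M. N. Huxley, N. Watt, *Exponential sums and the Riemann zeta function*, Proc. London Math. Soc.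
  (3) 57 (1988), 1–24 — §4. [HuxleyWatt1988]
-/

noncomputable section

open Real Complex MeasureTheory Set intervalIntegral Finset
open Literature.Analysis.Fourier.AiryHardy (trap trap_eq_left trap_eq_mid trap_eq_right continuous_trap
  trap_nonneg trap_le_one trap_eq_zero GrahamKolesnik_lemma78 GrahamKolesnik_lemma79)
open Literature.NumberTheory.EllipticCurves.ModularForms (quadGaussSum quadGaussSum_def)

namespace Literature.NumberTheory.LFunctions
namespace CubicSum

open Literature.NumberTheory.LFunctions.AFE (sawEta sawEta_nonneg exists_sawEta_le)

/-! ### The sums and the Airy–Hardy integral -/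

/-- The shifted, twisted incomplete cubic Gauss sum
`S = ∑_{N < n ≤ N₁} e(μ(n+s)³ + λn) e((an² + bn)/q)` (`e(t) = exp(2πit)`); for `s = λ = 0` this is
Graham–Kolesnik's `S(μ; a, b; q)` (before Lemma 7.16). [cite: GrahamKolesnik1991, §7.4 before Lemma 7.16] -/
def cubicSum (q : ℕ) [NeZero q] (a b : ℤ) (μ s lam N N₁ : ℝ) : ℂ :=
  ∑ n ∈ Finset.Ioc ⌊N⌋₊ ⌊N₁⌋₊, Complex.exp (2 * π * I * (μ * (n + s) ^ 3 + lam * n : ℝ)) *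
    (ZMod.stdAddChar ((a * n ^ 2 + b * n : ℤ) : ZMod q) : ℂ)

/-- The same sum with the trapezoid weight `g` of `[N, N₁ + 1]`
(`Literature.Analysis.Fourier.AiryHardy.trap`). [cite: GrahamKolesnik1991, Lemma 7.16 (proof, first display)] -/
def cubicTrapSum (q : ℕ) [NeZero q] (a b : ℤ) (μ s lam N N₁ : ℝ) : ℂ :=
  ∑ n ∈ Finset.Ioc ⌊N⌋₊ ⌊N₁ + 1⌋₊, (trap N N₁ n : ℂ) *
    (Complex.exp (2 * π * I * (μ * (n + s) ^ 3 + lam * n : ℝ)) *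
      (ZMod.stdAddChar ((a * n ^ 2 + b * n : ℤ) : ZMod q) : ℂ))

/-- The Airy–Hardy integral with trapezoid weight: `J(μ, c; P, P₁; h) = ∫_P^{P₁+1} g(y) e(μy³ - (h/c) y) dy`,
the integral of Graham–Kolesnik's Lemmas 7.8–7.9. [cite: GrahamKolesnik1991, Lemmas 7.8–7.9] -/
def airyTrap (μ c P P₁ h : ℝ) : ℂ :=
  ∫ y in P..(P₁ + 1), (trap P P₁ y : ℂ) * Complex.exp (2 * π * I * (μ * y ^ 3 - h / c * y : ℝ))

/-- The summand of `cubicSum` has modulus `1`. [folklore] -/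
theorem norm_summand (q : ℕ) [NeZero q] (a b : ℤ) (μ s lam : ℝ) (n : ℕ) :
    ‖Complex.exp (2 * π * I * (μ * (n + s) ^ 3 + lam * n : ℝ)) *
      (ZMod.stdAddChar ((a * n ^ 2 + b * n : ℤ) : ZMod q) : ℂ)‖ = 1 := by
  rw [norm_mul, norm_e_real, ZMod.stdAddChar_apply, Circle.norm_coe, mul_one]

/-- **Inserting the trapezoid weight costs at most `2`:** `‖S - S_g‖ ≤ 2`
(one term with `N < n < N + 1`, one with `N₁ < n ≤ N₁ + 1`).
[cite: GrahamKolesnik1991, Lemma 7.16 (proof, "+ O(1)")] -/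
theorem norm_cubicSum_sub_cubicTrapSum_le (q : ℕ) [NeZero q] (a b : ℤ) (μ s lam : ℝ) {N N₁ : ℝ}
    (hN : 0 ≤ N) (hNN₁ : N + 1 ≤ N₁) :
    ‖cubicSum q a b μ s lam N N₁ - cubicTrapSum q a b μ s lam N N₁‖ ≤ 2 := by
  set F : ℕ → ℂ := fun n => Complex.exp (2 * π * I * (μ * (n + s) ^ 3 + lam * n : ℝ)) *
      (ZMod.stdAddChar ((a * n ^ 2 + b * n : ℤ) : ZMod q) : ℂ) with hF
  have hFn : ∀ n, ‖F n‖ = 1 := fun n => norm_summand q a b μ s lam n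
  have hN₁0 : 0 ≤ N₁ := by linarith
  have hfl1 : ⌊N₁ + 1⌋₊ = ⌊N₁⌋₊ + 1 := Nat.floor_add_one hN₁0
  have hm : ⌊N⌋₊ + 1 ≤ ⌊N₁⌋₊ := by
    have : ⌊N + 1⌋₊ ≤ ⌊N₁⌋₊ := Nat.floor_le_floor hNN₁
    rwa [Nat.floor_add_one hN] at this
  -- split the sums
  have hS : cubicSum q a b μ s lam N N₁ = F (⌊N⌋₊ + 1) + ∑ n ∈ Finset.Ioc (⌊N⌋₊ + 1) ⌊N₁⌋₊, F n := by
    rw [cubicSum, ← Finset.sum_Ioc_consecutive F (Nat.le_succ _) hm, Nat.Ioc_succ_singleton,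
      Finset.sum_singleton]
  have hT : cubicTrapSum q a b μ s lam N N₁ = (trap N N₁ (⌊N⌋₊ + 1 : ℕ) : ℂ) * F (⌊N⌋₊ + 1)
      + ∑ n ∈ Finset.Ioc (⌊N⌋₊ + 1) ⌊N₁⌋₊, (trap N N₁ n : ℂ) * F n
      + (trap N N₁ (⌊N₁⌋₊ + 1 : ℕ) : ℂ) * F (⌊N₁⌋₊ + 1) := by
    rw [cubicTrapSum, hfl1, ← Finset.sum_Ioc_consecutive _ (Nat.le_succ ⌊N⌋₊) (hm.trans (Nat.le_succ _)),
      Nat.Ioc_succ_singleton, Finset.sum_singleton,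
      ← Finset.sum_Ioc_consecutive _ hm (Nat.le_succ _), Nat.Ioc_succ_singleton, Finset.sum_singleton]
    simp only [hF, add_assoc]
  -- on the middle range the weight is `1`
  have hmid : ∑ n ∈ Finset.Ioc (⌊N⌋₊ + 1) ⌊N₁⌋₊, (trap N N₁ n : ℂ) * F n =
      ∑ n ∈ Finset.Ioc (⌊N⌋₊ + 1) ⌊N₁⌋₊, F n := by
    refine Finset.sum_congr rfl fun n hn => ?_
    rw [Finset.mem_Ioc] at hn
    have h1 : N + 1 ≤ (n : ℝ) := by
      have : (⌊N⌋₊ + 1 : ℕ) + 1 ≤ n := hn.1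
      have h2 : N < (⌊N⌋₊ : ℝ) + 1 := Nat.lt_floor_add_one N
      have h3 : ((⌊N⌋₊ + 1 + 1 : ℕ) : ℝ) ≤ n := by exact_mod_cast this
      push_cast at h3; linarith
    have h2 : (n : ℝ) ≤ N₁ := by
      have := hn.2
      exact (Nat.le_floor_iff hN₁0).1 this
    rw [trap_eq_mid ⟨h1, h2⟩]; simp
  rw [hS, hT, hmid]
  have e : F (⌊N⌋₊ + 1) + ∑ n ∈ Finset.Ioc (⌊N⌋₊ + 1) ⌊N₁⌋₊, F n -
      ((trap N N₁ (⌊N⌋₊ + 1 : ℕ) : ℂ) * F (⌊N⌋₊ + 1) + ∑ n ∈ Finset.Ioc (⌊N⌋₊ + 1) ⌊N₁⌋₊, F n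
        + (trap N N₁ (⌊N₁⌋₊ + 1 : ℕ) : ℂ) * F (⌊N₁⌋₊ + 1)) =
      ((1 - trap N N₁ (⌊N⌋₊ + 1 : ℕ) : ℝ) : ℂ) * F (⌊N⌋₊ + 1)
        - (trap N N₁ (⌊N₁⌋₊ + 1 : ℕ) : ℂ) * F (⌊N₁⌋₊ + 1) := by
    push_cast; ring
  rw [e]
  have h1 : ‖((1 - trap N N₁ (⌊N⌋₊ + 1 : ℕ) : ℝ) : ℂ) * F (⌊N⌋₊ + 1)‖ ≤ 1 := by
    rw [norm_mul, hFn, mul_one, Complex.norm_real, Real.norm_eq_abs, abs_le]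
    constructor <;> linarith [trap_nonneg N N₁ (⌊N⌋₊ + 1 : ℕ), trap_le_one N N₁ (⌊N⌋₊ + 1 : ℕ)]
  have h2 : ‖(trap N N₁ (⌊N₁⌋₊ + 1 : ℕ) : ℂ) * F (⌊N₁⌋₊ + 1)‖ ≤ 1 := by
    rw [norm_mul, hFn, mul_one, Complex.norm_real, Real.norm_eq_abs, abs_of_nonneg (trap_nonneg _ _ _)]
    exact trap_le_one _ _ _
  exact (norm_sub_le _ _).trans (by linarith)

/-- The character factor as an exponential: `ψ(k·n) = e(k.val n / q)`. [folklore] -/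
theorem stdAddChar_mul_natCast {q : ℕ} [NeZero q] (k : ZMod q) (n : ℕ) :
    (ZMod.stdAddChar (k * (n : ZMod q)) : ℂ) = Complex.exp (2 * π * I * ((k.val : ℝ) * n / q : ℝ)) := by
  have : k * (n : ZMod q) = (((k.val * n : ℕ) : ℤ) : ZMod q) := by
    push_cast; rw [ZMod.natCast_zmod_val]
  rw [this, ZMod.stdAddChar_coe]
  congr 1; push_cast; ring

/-! ### Regrouping by residue classes -/

/-- The inner sums after regrouping by residue classes:
`I_k = ∑_n g(n) e(μ(n+s)³ + λn + k n/q)`. [cite: GrahamKolesnik1991, Lemma 7.16 (proof)] -/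
def innerSum (q : ℕ) [NeZero q] (μ s lam N N₁ : ℝ) (k : ZMod q) : ℂ :=
  ∑ n ∈ Finset.Ioc ⌊N⌋₊ ⌊N₁ + 1⌋₊, (trap N N₁ n : ℂ) *
    Complex.exp (2 * π * I * (μ * (n + s) ^ 3 + lam * n + (k.val : ℝ) / q * n : ℝ))

/-- **Regrouping by residue classes:** `S_g = q⁻¹ ∑_{k mod q} G(a, b - k; q) I_k`.
[cite: GrahamKolesnik1991, Lemma 7.16 (proof, second and third displays)] -/
theorem cubicTrapSum_eq_sum_gauss (q : ℕ) [NeZero q] (a b : ℤ) (μ s lam N N₁ : ℝ) :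
    cubicTrapSum q a b μ s lam N N₁ =
      (1 / (q : ℂ)) * ∑ k : ZMod q, quadGaussSum q a ((b : ZMod q) - k) * innerSum q μ s lam N N₁ k := by
  classical
  set F : ℤ → ℂ := fun m => (trap N N₁ m : ℂ) * Complex.exp (2 * π * I * (μ * (m + s) ^ 3 + lam * m : ℝ))
    with hF
  have hP := sum_quadPhase_mul_eq (c := q) a b ((Finset.Ioc ⌊N⌋₊ ⌊N₁ + 1⌋₊).map Nat.castEmbedding) F
  rw [Finset.sum_map] at hP
  simp_rw [Finset.sum_map] at hP
  have hL : cubicTrapSum q a b μ s lam N N₁ =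
      ∑ n ∈ Finset.Ioc ⌊N⌋₊ ⌊N₁ + 1⌋₊,
        (ZMod.stdAddChar (((a * (Nat.castEmbedding n) ^ 2 + b * (Nat.castEmbedding n) : ℤ)) : ZMod q) : ℂ)
          * F (Nat.castEmbedding n) := by
    rw [cubicTrapSum]
    refine Finset.sum_congr rfl fun n _ => ?_
    simp only [hF, Nat.castEmbedding_apply, Int.cast_natCast]
    ring
  rw [hL, hP]
  congr 1
  refine Finset.sum_congr rfl fun k _ => ?_
  congr 1
  rw [innerSum]
  refine Finset.sum_congr rfl fun n _ => ?_
  simp only [hF, Nat.castEmbedding_apply, Int.cast_natCast]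
  rw [stdAddChar_mul_natCast, mul_assoc, ← Complex.exp_add]
  congr 2
  push_cast; ring

/-! ### Combinatorial reindexing lemmas -/

/-- `∑_{ν=-V}^{V} F(ν) = F(0) + ∑_{ν=1}^{V} (F(ν) + F(-ν))`. [folklore] -/
theorem sum_Icc_neg_eq {M : Type*} [AddCommMonoid M] (F : ℤ → M) (V : ℕ) :
    ∑ ν ∈ Finset.Icc (-(V : ℤ)) V, F ν = F 0 + ∑ ν ∈ Finset.Icc 1 V, (F ν + F (-(ν : ℤ))) := by
  classical
  set negEmb : ℕ ↪ ℤ := ⟨fun ν : ℕ => -(ν : ℤ), fun a b h => by simpa using h⟩ with hnegEmb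
  have hdecomp : Finset.Icc (-(V : ℤ)) V =
      ((Finset.Icc 1 V).map negEmb ∪ {0}) ∪ (Finset.Icc 1 V).map Nat.castEmbedding := by
    ext h
    simp only [Finset.mem_Icc, Finset.mem_union, Finset.mem_map, Finset.mem_singleton,
      Nat.castEmbedding_apply, hnegEmb, Function.Embedding.coeFn_mk]
    constructor
    · intro hh
      rcases lt_trichotomy h 0 with hlt | heq | hgt
      · left; left
        refine ⟨h.natAbs, ⟨by omega, by omega⟩, by omega⟩
      · left; right; exact heq
      · right
        refine ⟨h.toNat, ⟨by omega, by omega⟩, by omega⟩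
    · rintro ((⟨ν, hν, rfl⟩ | rfl) | ⟨ν, hν, rfl⟩) <;> omega
  have hd1 : Disjoint ((Finset.Icc 1 V).map negEmb) {0} := by
    rw [Finset.disjoint_singleton_right, Finset.mem_map]
    rintro ⟨ν, hν, h0⟩
    simp only [hnegEmb, Function.Embedding.coeFn_mk, neg_eq_zero, Nat.cast_eq_zero] at h0
    rw [Finset.mem_Icc] at hν; omega
  have hd2 : Disjoint ((Finset.Icc 1 V).map negEmb ∪ {0}) ((Finset.Icc 1 V).map Nat.castEmbedding) := by
    rw [Finset.disjoint_left]
    intro h hh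
    simp only [Finset.mem_union, Finset.mem_map, Finset.mem_singleton, hnegEmb,
      Function.Embedding.coeFn_mk, Nat.castEmbedding_apply, Finset.mem_Icc] at hh ⊢
    rintro ⟨ν, hν, rfl⟩
    rcases hh with ⟨ν', hν', h'⟩ | h0
    · omega
    · omega
  rw [hdecomp, Finset.sum_union hd2, Finset.sum_union hd1, Finset.sum_singleton, Finset.sum_map,
    Finset.sum_map, Finset.sum_add_distrib]
  simp only [hnegEmb, Function.Embedding.coeFn_mk, Nat.castEmbedding_apply]
  abel

section Residues

variable {q : ℕ} [NeZero q]

/-- **Joining residue classes and Poisson frequencies:** `(k, ν) ↦ k + νq` is a bijection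
`ℤ/qℤ × [-V, V] → [-Vq, Vq + q)`, so that
`∑_{k mod q} ∑_{ν=-V}^{V} g(k̃ + νq) = ∑_{-Vq ≤ h' < Vq+q} g(h')` (`k̃ ∈ [0, q)` the representative of
`k`). [folklore] -/
theorem sum_zmod_sum_Icc_eq_sum_Ico (g : ℤ → ℂ) (V : ℕ) :
    ∑ k : ZMod q, ∑ ν ∈ Finset.Icc (-(V : ℤ)) V, g ((k.val : ℤ) + ν * q) =
      ∑ h' ∈ Finset.Ico (-(V : ℤ) * q) ((V : ℤ) * q + q), g h' := by
  classical
  have hq0 : (0 : ℤ) < q := by exact_mod_cast Nat.pos_of_ne_zero (NeZero.ne q)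
  rw [← Finset.sum_product' (s := (Finset.univ : Finset (ZMod q))) (t := Finset.Icc (-(V : ℤ)) V)
    (f := fun k ν => g ((k.val : ℤ) + ν * q))]
  refine Finset.sum_nbij' (fun p => ((p.1.val : ℤ) + p.2 * q)) (fun h' => ((h' : ZMod q), h' / q))
    ?_ ?_ ?_ ?_ ?_
  · rintro ⟨k, ν⟩ hp
    simp only [Finset.mem_product, Finset.mem_univ, true_and, Finset.mem_Icc] at hp
    have hk0 : (0 : ℤ) ≤ k.val := by positivity
    have hkq : (k.val : ℤ) < q := by exact_mod_cast ZMod.val_lt k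
    rw [Finset.mem_Ico]
    constructor <;> nlinarith
  · intro h' hh
    rw [Finset.mem_Ico] at hh
    simp only [Finset.mem_product, Finset.mem_univ, true_and, Finset.mem_Icc]
    constructor
    · exact Int.le_ediv_of_mul_le hq0 (by linarith)
    · have : h' / q < V + 1 := Int.ediv_lt_of_lt_mul hq0 (by linarith)
      omega
  · rintro ⟨k, ν⟩ _
    simp only
    have hk0 : (0 : ℤ) ≤ k.val := by positivity
    have hkq : (k.val : ℤ) < q := by exact_mod_cast ZMod.val_lt k
    ext
    · push_cast
      simp
    · simp only
      rw [Int.add_mul_ediv_right _ _ hq0.ne', Int.ediv_eq_zero_of_lt hk0 hkq, zero_add]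
  · intro h' _
    simp only
    rw [ZMod.val_intCast, mul_comm]
    exact Int.emod_add_mul_ediv h' q
  · rintro ⟨k, ν⟩ _
    rfl

omit [NeZero q] in
/-- Reflection `h ↦ -h`: `∑_{-Vq ≤ h' < Vq+q} g(h') = ∑_{-Vq-q < h ≤ Vq} g(-h)`. [folklore] -/
theorem sum_Ico_eq_sum_Ioc_neg (g : ℤ → ℂ) (V : ℕ) :
    ∑ h' ∈ Finset.Ico (-(V : ℤ) * q) ((V : ℤ) * q + q), g h' =
      ∑ h ∈ Finset.Ioc (-(V : ℤ) * q - q) ((V : ℤ) * q), g (-h) := by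
  rw [neg_mul]
  refine Finset.sum_nbij' (fun h => -h) (fun h => -h) ?_ ?_ ?_ ?_ ?_
  · intro h hh; rw [Finset.mem_Ico] at hh; rw [Finset.mem_Ioc]; omega
  · intro h hh; rw [Finset.mem_Ioc] at hh; rw [Finset.mem_Ico]; omega
  · intro h _; simp
  · intro h _; simp
  · intro h _; simp

end Residues

/-! ### Poisson summation for the inner sums -/

section Poisson

variable {q : ℕ} [NeZero q]

/-- The Fourier integrals `A(h') = ∫_N^{N₁+1} g(x) e(μ(x+s)³ + λx + (h'/q)x) dx`.
[cite: GrahamKolesnik1991, Lemma 7.16 (proof, "Poisson summation")] -/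
def poissonInt (q : ℕ) (μ s lam N N₁ : ℝ) (h' : ℤ) : ℂ :=
  ∫ x in N..(N₁ + 1), (trap N N₁ x : ℂ) *
    Complex.exp (2 * π * I * (μ * (x + s) ^ 3 + lam * x + (h' : ℝ) / q * x : ℝ))

/-- **Truncated Poisson summation of `I_k`:**
`‖I_k - ∑_{ν=-V}^{V} A(k̃ + νq)‖ ≤ (1 + 2πT)(N₁ - N + 7) η_V`, `T = 3μ(N₁+s+1)² + 2`.
[cite: GrahamKolesnik1991, Lemma 7.16 (proof)] -/
theorem norm_innerSum_sub_le {μ s lam N N₁ : ℝ} (hμ : 0 ≤ μ) (hN : 0 ≤ N) (hNN₁ : N + 1 ≤ N₁)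
    (hs : 0 ≤ N + s) (hlam : |lam| ≤ 1) {V : ℕ} (hV : 1 ≤ V) (k : ZMod q) :
    ‖innerSum q μ s lam N N₁ k -
        ∑ ν ∈ Finset.Icc (-(V : ℤ)) V, poissonInt q μ s lam N N₁ ((k.val : ℤ) + ν * q)‖
      ≤ (1 + 2 * π * (3 * μ * (N₁ + s + 1) ^ 2 + 2)) * (N₁ - N + 7) * sawEta V := by
  have hq0 : (0 : ℝ) < q := by exact_mod_cast Nat.pos_of_ne_zero (NeZero.ne q)
  have hkq : (k.val : ℝ) / q < 1 := by
    rw [div_lt_one hq0]; exact_mod_cast ZMod.val_lt k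
  have hk0 : 0 ≤ (k.val : ℝ) / q := by positivity
  set θ : ℝ → ℝ := fun x => μ * (x + s) ^ 3 + lam * x + (k.val : ℝ) / q * x with hθ
  set θ' : ℝ → ℝ := fun x => 3 * μ * (x + s) ^ 2 + lam + (k.val : ℝ) / q with hθ'
  have hθd : ∀ x ∈ Icc N (N₁ + 1), HasDerivAt θ (θ' x) x := by
    intro x _
    simp only [hθ, hθ']
    have h1 : HasDerivAt (fun x : ℝ => μ * (x + s) ^ 3) (μ * (3 * (x + s) ^ 2 * 1)) x :=
      (((hasDerivAt_id x).add_const s).pow 3).const_mul μ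
    have h2 : HasDerivAt (fun x : ℝ => lam * x) (lam * 1) x := (hasDerivAt_id x).const_mul lam
    have h3 : HasDerivAt (fun x : ℝ => (k.val : ℝ) / q * x) ((k.val : ℝ) / q * 1) x :=
      (hasDerivAt_id x).const_mul _
    exact ((h1.add h2).add h3).congr_deriv (by ring)
  have hθ'c : ContinuousOn θ' (Icc N (N₁ + 1)) := Continuous.continuousOn (by simp only [hθ']; fun_prop)
  have hT : ∀ x ∈ Icc N (N₁ + 1), |θ' x| ≤ 3 * μ * (N₁ + s + 1) ^ 2 + 2 := by
    intro x hx
    simp only [hθ']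
    have hxs : 0 ≤ x + s := by linarith [hx.1]
    have hxs' : x + s ≤ N₁ + s + 1 := by linarith [hx.2]
    have h1 : 0 ≤ 3 * μ * (x + s) ^ 2 := by positivity
    have h2 : 3 * μ * (x + s) ^ 2 ≤ 3 * μ * (N₁ + s + 1) ^ 2 := by
      gcongr
    rw [abs_le] at hlam ⊢
    constructor <;> nlinarith
  have hE := trap_expansion (θ := θ) (θ' := θ') hN hNN₁ hV hθd hθ'c hT
  -- identify the expansion with `∑_ν A(k̃ + νq)`
  have hint : ∀ ν : ℤ, (∫ x in N..(N₁ + 1), (trap N N₁ x : ℂ) * Complex.exp (2 * π * I * θ x) *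
      Complex.exp (2 * π * I * ν * x)) = poissonInt q μ s lam N N₁ ((k.val : ℤ) + ν * q) := by
    intro ν
    rw [poissonInt]
    refine intervalIntegral.integral_congr fun x _ => ?_
    have hr : θ x + ν * x = μ * (x + s) ^ 3 + lam * x + (((k.val : ℤ) + ν * q : ℤ) : ℝ) / q * x := by
      simp only [hθ]; push_cast; field_simp; ring
    rw [mul_assoc, ← Complex.exp_add]
    congr 2
    rw [← hr]; push_cast; ring
  have hsum : (∫ x in N..(N₁ + 1), (trap N N₁ x : ℂ) * Complex.exp (2 * π * I * θ x))
      + ∑ ν ∈ Finset.Icc 1 V,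
        ((∫ x in N..(N₁ + 1), (trap N N₁ x : ℂ) * Complex.exp (2 * π * I * θ x) * Complex.exp (2 * π * I * ν * x))
          + ∫ x in N..(N₁ + 1), (trap N N₁ x : ℂ) * Complex.exp (2 * π * I * θ x) * Complex.exp (-(2 * π * I * ν * x)))
      = ∑ ν ∈ Finset.Icc (-(V : ℤ)) V, poissonInt q μ s lam N N₁ ((k.val : ℤ) + ν * q) := by
    rw [sum_Icc_neg_eq]
    congr 1
    · rw [← hint 0]; simp
    · refine Finset.sum_congr rfl fun ν _ => ?_
      have h1 := hint ν
      have h2 := hint (-(ν : ℤ))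
      push_cast at h1 h2
      rw [← h1, ← h2]
      congr 1
      refine intervalIntegral.integral_congr fun x _ => ?_
      congr 2
      ring
  have hI : innerSum q μ s lam N N₁ k =
      ∑ n ∈ Finset.Ioc ⌊N⌋₊ ⌊N₁ + 1⌋₊, (trap N N₁ n : ℂ) * Complex.exp (2 * π * I * θ n) := by
    rw [innerSum]
  rw [hI, ← hsum]
  exact hE


/-- **`S_g` as a sum of Gauss sums times Fourier integrals** (Graham–Kolesnik, proof of Lemma 7.16,
fourth display, in truncated form): for `V ≥ 1`,
`‖S_g - q⁻¹ ∑_{-Vq-q < h ≤ Vq} G(a, b + h; q) A(-h)‖ ≤ (2q)^{1/2} (1 + 2πT)(N₁ - N + 7) η_V`,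
`T = 3μ(N₁ + s + 1)² + 2`; the right-hand side tends to `0` as `V → ∞`.
[cite: GrahamKolesnik1991, Lemma 7.16 (proof)] -/
theorem norm_cubicTrapSum_sub_sum_poissonInt_le {a : ℤ} (ha : IsUnit (a : ZMod q)) (b : ℤ)
    {μ s lam N N₁ : ℝ} (hμ : 0 ≤ μ) (hN : 0 ≤ N) (hNN₁ : N + 1 ≤ N₁) (hs : 0 ≤ N + s) (hlam : |lam| ≤ 1)
    {V : ℕ} (hV : 1 ≤ V) :
    ‖cubicTrapSum q a b μ s lam N N₁ -
        (1 / (q : ℂ)) * ∑ h ∈ Finset.Ioc (-(V : ℤ) * q - q) ((V : ℤ) * q),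
          quadGaussSum q a ((b : ZMod q) + (h : ZMod q)) * poissonInt q μ s lam N N₁ (-h)‖
      ≤ Real.sqrt (2 * q) * ((1 + 2 * π * (3 * μ * (N₁ + s + 1) ^ 2 + 2)) * (N₁ - N + 7) * sawEta V) := by
  classical
  have hq0 : (0 : ℝ) < q := by exact_mod_cast Nat.pos_of_ne_zero (NeZero.ne q)
  set B : ℝ := (1 + 2 * π * (3 * μ * (N₁ + s + 1) ^ 2 + 2)) * (N₁ - N + 7) * sawEta V with hB
  set P : ZMod q → ℂ := fun k => ∑ ν ∈ Finset.Icc (-(V : ℤ)) V,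
    poissonInt q μ s lam N N₁ ((k.val : ℤ) + ν * q) with hP
  -- the reindexing
  have hre : ∑ k : ZMod q, quadGaussSum q a ((b : ZMod q) - k) * P k =
      ∑ h ∈ Finset.Ioc (-(V : ℤ) * q - q) ((V : ℤ) * q),
        quadGaussSum q a ((b : ZMod q) + (h : ZMod q)) * poissonInt q μ s lam N N₁ (-h) := by
    set g : ℤ → ℂ := fun h' => quadGaussSum q a ((b : ZMod q) - (h' : ZMod q)) * poissonInt q μ s lam N N₁ h'
      with hg
    have h1 : ∑ k : ZMod q, quadGaussSum q a ((b : ZMod q) - k) * P k =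
        ∑ k : ZMod q, ∑ ν ∈ Finset.Icc (-(V : ℤ)) V, g ((k.val : ℤ) + ν * q) := by
      refine Finset.sum_congr rfl fun k _ => ?_
      simp only [hP, Finset.mul_sum, hg]
      refine Finset.sum_congr rfl fun ν _ => ?_
      congr 2
      push_cast
      simp
    rw [h1, sum_zmod_sum_Icc_eq_sum_Ico g V, sum_Ico_eq_sum_Ioc_neg g V]
    refine Finset.sum_congr rfl fun h _ => ?_
    simp only [hg, Int.cast_neg, sub_neg_eq_add]
  rw [cubicTrapSum_eq_sum_gauss, ← hre, ← mul_sub, ← Finset.sum_sub_distrib]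
  have hterm : ∀ k : ZMod q, ‖quadGaussSum q a ((b : ZMod q) - k) * innerSum q μ s lam N N₁ k -
      quadGaussSum q a ((b : ZMod q) - k) * P k‖ ≤ Real.sqrt (2 * q) * B := by
    intro k
    rw [← mul_sub, norm_mul]
    exact mul_le_mul (norm_quadGaussSum_le_sqrt ha _) (norm_innerSum_sub_le hμ hN hNN₁ hs hlam hV k)
      (norm_nonneg _) (Real.sqrt_nonneg _)
  calc ‖(1 / (q : ℂ)) * ∑ k : ZMod q, (quadGaussSum q a ((b : ZMod q) - k) * innerSum q μ s lam N N₁ k -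
          quadGaussSum q a ((b : ZMod q) - k) * P k)‖
      ≤ ‖(1 / (q : ℂ))‖ * ∑ k : ZMod q, ‖quadGaussSum q a ((b : ZMod q) - k) * innerSum q μ s lam N N₁ k -
          quadGaussSum q a ((b : ZMod q) - k) * P k‖ := by
        rw [norm_mul]; gcongr; exact norm_sum_le _ _
    _ ≤ (1 / q) * ∑ _k : ZMod q, Real.sqrt (2 * q) * B := by
        gcongr with k
        · rw [norm_div, norm_one, Complex.norm_natCast]
        · exact hterm k
    _ = Real.sqrt (2 * q) * B := by
        rw [Finset.sum_const, Finset.card_univ, ZMod.card, nsmul_eq_mul]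
        field_simp

end Poisson

/-! ### Completing the shift, and the tail bounds -/

section Tails

variable {q : ℕ} [NeZero q]

/-- Shifting the trapezoid: `g_{N,N₁}(x) = g_{N+s,N₁+s}(x + s)`. [folklore] -/
theorem trap_add (N N₁ s x : ℝ) : trap N N₁ x = trap (N + s) (N₁ + s) (x + s) := by
  unfold Literature.Analysis.Fourier.AiryHardy.trap
  ring_nf

/-- **Completing the shift:** `A(-h) = e(ω s) J(μ, q; N+s, N₁+s; h - qλ)` with `ω = (h - qλ)/q`
(substitute `y = x + s`). [folklore] -/
theorem poissonInt_neg (μ s lam N N₁ : ℝ) (h : ℤ) :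
    poissonInt q μ s lam N N₁ (-h) =
      Complex.exp (2 * π * I * ((h - q * lam) / q * s : ℝ)) * airyTrap μ q (N + s) (N₁ + s) (h - q * lam) := by
  have hq0 : (q : ℂ) ≠ 0 := by exact_mod_cast NeZero.ne q
  rw [poissonInt, airyTrap, ← intervalIntegral.integral_const_mul,
    show N₁ + s + 1 = (N₁ + 1) + s by ring,
    ← intervalIntegral.integral_comp_add_right (fun y => Complex.exp (2 * π * I * ((h - q * lam) / q * s : ℝ)) *
      ((trap (N + s) (N₁ + s) y : ℂ) * Complex.exp (2 * π * I * (μ * y ^ 3 - (h - q * lam) / q * y : ℝ)))) s]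
  refine intervalIntegral.integral_congr fun x _ => ?_
  rw [← trap_add, mul_left_comm, ← Complex.exp_add]
  congr 2
  push_cast
  field_simp
  ring

/-! ### Pointwise bounds for the non-stationary frequencies -/

section PointwiseBounds

variable {μ s lam N N₁ : ℝ}

/-- Outside the window `(2μqN'², 4μq(N₁'+1)²)` for `h̃ = h - qλ` (`N' = N + s`, `N₁' = N₁ + s`):
`‖A(-h)‖ ≤ 7q/(μqN'² + |h̃|)` (Lemma 7.8). [cite: GrahamKolesnik1991, Lemma 7.8] -/
theorem norm_poissonInt_neg_le_of_not_window (hμ : 0 < μ) (hN' : 0 < N + s) (hNN₁ : N + 1 ≤ N₁) (h : ℤ)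
    (hh : (h : ℝ) - q * lam ≤ 2 * μ * q * (N + s) ^ 2 ∨ 4 * μ * q * (N₁ + s + 1) ^ 2 ≤ (h : ℝ) - q * lam) :
    ‖poissonInt q μ s lam N N₁ (-h)‖ ≤ 7 * q / (μ * q * (N + s) ^ 2 + |(h : ℝ) - q * lam|) := by
  have hq0 : (0 : ℝ) < q := by exact_mod_cast Nat.pos_of_ne_zero (NeZero.ne q)
  rw [poissonInt_neg, norm_mul]
  rw [show (2 * π * I * (((h : ℝ) - q * lam) / q * s : ℝ) : ℂ) = ((2 * π * (((h : ℝ) - q * lam) / q * s) : ℝ) : ℂ) * I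
    by push_cast; ring, Complex.norm_exp_ofReal_mul_I, one_mul, airyTrap]
  have := GrahamKolesnik_lemma78 (μ := μ) (c := q) (N := N + s) (N₁ := N₁ + s) (h := (h : ℝ) - q * lam)
    hμ hq0 hN' (by linarith) (by rcases hh with hh | hh <;> [left; right] <;> nlinarith)
  exact this

/-- Far from the window, `|h̃| ≥ 4μq(N₁'+1)²`: `‖A(-h)‖ ≤ 100(1 + μN'²)q²/h̃²` (Lemma 7.9).
[cite: GrahamKolesnik1991, Lemma 7.9] -/
theorem norm_poissonInt_neg_le_of_far (hμ : 0 < μ) (hN' : 1 ≤ N + s) (hNN₁ : N + 1 ≤ N₁)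
    (hN₁' : N₁ + s ≤ 2 * (N + s)) (h : ℤ) (hh : 4 * μ * q * (N₁ + s + 1) ^ 2 ≤ |(h : ℝ) - q * lam|) :
    ‖poissonInt q μ s lam N N₁ (-h)‖ ≤ 100 * (1 + μ * (N + s) ^ 2) * q ^ 2 / ((h : ℝ) - q * lam) ^ 2 := by
  have hq0 : (0 : ℝ) < q := by exact_mod_cast Nat.pos_of_ne_zero (NeZero.ne q)
  rw [poissonInt_neg, norm_mul]
  rw [show (2 * π * I * (((h : ℝ) - q * lam) / q * s : ℝ) : ℂ) = ((2 * π * (((h : ℝ) - q * lam) / q * s) : ℝ) : ℂ) * I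
    by push_cast; ring, Complex.norm_exp_ofReal_mul_I, one_mul, airyTrap]
  have := GrahamKolesnik_lemma79 (μ := μ) (c := q) (N := N + s) (N₁ := N₁ + s) (h := (h : ℝ) - q * lam)
    hμ hq0 hN' (by linarith) hN₁' (by nlinarith)
  exact this

end PointwiseBounds

/-! ### Elementary sums -/

/-- `∑_{h=1}^{n} 1/h ≤ 1 + log n`. [folklore] -/
theorem sum_Icc_inv_le_log (n : ℕ) :
    ∑ h ∈ Finset.Icc 1 n, (1 / (h : ℝ)) ≤ 1 + Real.log n := by
  have h1 := harmonic_le_one_add_log n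
  have h2 : (harmonic n : ℝ) = ∑ h ∈ Finset.Icc 1 n, (1 / (h : ℝ)) := by
    simp [harmonic_eq_sum_Icc]
  linarith [h2]

/-- Telescoping identity: `∑_{h=m+1}^{k} 1/((h-1)h) = 1/m - 1/k` (`1 ≤ m ≤ k`). [folklore] -/
theorem sum_Icc_inv_mul_eq {m : ℕ} (hm : 1 ≤ m) {k : ℕ} (hk : m ≤ k) :
    ∑ h ∈ Finset.Icc (m + 1) k, (1 / (((h : ℝ) - 1) * h)) = 1 / m - 1 / k := by
  induction k, hk using Nat.le_induction with
  | base => simp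
  | succ k hk ih =>
    rw [Finset.sum_Icc_succ_top (by omega), ih]
    have hk0 : (0 : ℝ) < k := by exact_mod_cast (by omega : 0 < k)
    have hm0 : (0 : ℝ) < m := by exact_mod_cast hm
    push_cast
    rw [show ((k : ℝ) + 1 - 1) = k by ring]
    field_simp
    ring

/-- Telescoping: `∑_{h=m+1}^{n} 1/((h-1)h) ≤ 1/m` (`m ≥ 1`). [folklore] -/
theorem sum_Icc_inv_mul_le {m : ℕ} (hm : 1 ≤ m) (n : ℕ) :
    ∑ h ∈ Finset.Icc (m + 1) n, (1 / (((h : ℝ) - 1) * h)) ≤ 1 / m := by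
  rcases lt_or_ge n m with hnm | hnm
  · have : Finset.Icc (m + 1) n = ∅ := Finset.Icc_eq_empty (by omega)
    rw [this, Finset.sum_empty]; positivity
  · rw [sum_Icc_inv_mul_eq hm hnm]
    have : (0 : ℝ) ≤ 1 / (n : ℝ) := by positivity
    linarith

/-- `log 37 ≤ 4`. [folklore] -/
theorem log_37_le : Real.log 37 ≤ 4 := by
  rw [Real.log_le_iff_le_exp (by norm_num)]
  have h := Real.exp_one_gt_d9
  have : Real.exp 4 = Real.exp 1 ^ 4 := by rw [← Real.exp_nat_mul]; norm_num
  rw [this]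
  have h2 : (2.7182818283 : ℝ) ^ 4 ≤ Real.exp 1 ^ 4 := pow_le_pow_left₀ (by norm_num) h.le 4
  nlinarith [h2]

/-! ### The window of near-stationary frequencies -/

/-- The window `W = {h ∈ ℤ : 2μqN'² < h - qλ < 4μq(N₁' + 1)²}` (`N' = N + s`, `N₁' = N₁ + s`) of
frequencies whose Airy–Hardy integral is NOT covered by Lemma 7.8; it contains the stationary range
`3μqN'² ≤ h - qλ ≤ 3μqN₁'²` of Lemma 7.7. [cite: GrahamKolesnik1991, Lemma 7.16 (proof)] -/
def window (q : ℕ) (μ s lam N N₁ : ℝ) : Finset ℤ :=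
  Finset.Ioo ⌊q * lam + 2 * μ * q * (N + s) ^ 2⌋ ⌈q * lam + 4 * μ * q * (N₁ + s + 1) ^ 2⌉

omit [NeZero q] in
/-- Outside the window, the hypothesis of Lemma 7.8 holds. [folklore] -/
theorem not_mem_window {μ s lam N N₁ : ℝ} {h : ℤ} (hh : h ∉ window q μ s lam N N₁) :
    (h : ℝ) - q * lam ≤ 2 * μ * q * (N + s) ^ 2 ∨ 4 * μ * q * (N₁ + s + 1) ^ 2 ≤ (h : ℝ) - q * lam := by
  rw [window, Finset.mem_Ioo, not_and_or, not_lt, not_lt] at hh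
  rcases hh with hh | hh
  · left; have := Int.le_floor.1 hh; linarith
  · right; have := Int.ceil_le.1 hh; linarith

omit [NeZero q] in
/-- The window lies in `[0, 36q]` when `|qλ| ≤ 1/2`, `μ > 0`, `1 ≤ N'`, `N₁' ≤ 2N'`, `μN'² ≤ 1`. [folklore] -/
theorem mem_window_bounds {μ s lam N N₁ : ℝ} (hμ : 0 < μ) (hNN₁ : N + 1 ≤ N₁) (hN' : 1 ≤ N + s)
    (hN₁' : N₁ + s ≤ 2 * (N + s)) (hμN : μ * (N + s) ^ 2 ≤ 1) (hlam : |q * lam| ≤ 1 / 2) {h : ℤ}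
    (hh : h ∈ window q μ s lam N N₁) :
    0 ≤ h ∧ h ≤ 36 * q := by
  rw [window, Finset.mem_Ioo] at hh
  have hq : (0 : ℝ) ≤ q := Nat.cast_nonneg _
  rw [abs_le] at hlam
  have h1 := Int.floor_lt.1 hh.1
  have h2 := Int.lt_ceil.1 hh.2
  have hpos : 0 ≤ 2 * μ * q * (N + s) ^ 2 := by positivity
  have hup : 4 * μ * q * (N₁ + s + 1) ^ 2 ≤ 36 * q := by
    have : (N₁ + s + 1) ^ 2 ≤ 9 * (N + s) ^ 2 := by
      have h0 : 0 ≤ N₁ + s + 1 := by linarith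
      have h3 : N₁ + s + 1 ≤ 3 * (N + s) := by linarith
      nlinarith [pow_le_pow_left₀ h0 h3 2]
    calc 4 * μ * q * (N₁ + s + 1) ^ 2 ≤ 4 * μ * q * (9 * (N + s) ^ 2) := by gcongr
      _ = 36 * q * (μ * (N + s) ^ 2) := by ring
      _ ≤ 36 * q * 1 := by gcongr
      _ = 36 * q := by ring
  constructor
  · have : (-1 : ℝ) < h := by linarith
    exact_mod_cast (show (-1 : ℤ) < h by exact_mod_cast this)
  · have : (h : ℝ) < 36 * q + 1 := by linarith
    have : h < 36 * (q : ℤ) + 1 := by exact_mod_cast this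
    omega

/-! ### The non-stationary frequencies: summing the tail bounds -/

/-- The majorant `β(h)` of `‖A(-h)‖` for `h ∉ W`: `7/(μN'²)` at `h = 0`, `14q/|h|` for
`1 ≤ |h| ≤ 37q`, `200q²/((|h|-1)|h|)` beyond. [folklore] -/
def tailBound (q : ℕ) (μ N' : ℝ) (h : ℤ) : ℝ :=
  if h = 0 then 7 / (μ * N' ^ 2)
  else if |(h : ℝ)| ≤ 37 * q then 14 * q / |(h : ℝ)| else 200 * q ^ 2 / ((|(h : ℝ)| - 1) * |(h : ℝ)|)

omit [NeZero q] in
/-- `β(h) ≥ 0`. [folklore] -/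
theorem tailBound_nonneg {μ N' : ℝ} (hμ : 0 ≤ μ) (h : ℤ) : 0 ≤ tailBound q μ N' h := by
  simp only [tailBound]
  split_ifs with h0 h1
  · positivity
  · positivity
  · have : (1 : ℝ) ≤ |(h : ℝ)| := by
      have : (1 : ℤ) ≤ |h| := Int.one_le_abs h0
      have := (Int.cast_le (R := ℝ)).2 this
      push_cast at this; exact this
    apply div_nonneg (by positivity)
    exact mul_nonneg (by linarith) (abs_nonneg _)

omit [NeZero q] in
/-- `β(-h) = β(h)`. [folklore] -/
theorem tailBound_neg (μ N' : ℝ) (h : ℤ) : tailBound q μ N' (-h) = tailBound q μ N' h := by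
  simp only [tailBound, neg_eq_zero, Int.cast_neg, abs_neg]

/-- **Pointwise:** `‖A(-h)‖ ≤ β(h)` for `h ∉ W`. [cite: GrahamKolesnik1991, Lemma 7.16 (proof), Lemmas 7.8–7.9] -/
theorem norm_poissonInt_neg_le_tailBound {μ s lam N N₁ : ℝ} (hμ : 0 < μ) (hN' : 1 ≤ N + s)
    (hNN₁ : N + 1 ≤ N₁) (hN₁' : N₁ + s ≤ 2 * (N + s)) (hμN : μ * (N + s) ^ 2 ≤ 1) (hlam : |q * lam| ≤ 1 / 2)
    {h : ℤ} (hh : h ∉ window q μ s lam N N₁) :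
    ‖poissonInt q μ s lam N N₁ (-h)‖ ≤ tailBound q μ (N + s) h := by
  have hq0 : (0 : ℝ) < q := by exact_mod_cast Nat.pos_of_ne_zero (NeZero.ne q)
  have hH₀ : 0 < μ * q * (N + s) ^ 2 := by positivity
  have h78 := norm_poissonInt_neg_le_of_not_window hμ (by linarith) hNN₁ h (not_mem_window hh)
  -- `|h̃| ≥ |h| - 1/2`
  have htil : |(h : ℝ)| - 1 / 2 ≤ |(h : ℝ) - q * lam| := by
    have := abs_sub_abs_le_abs_sub (h : ℝ) (q * lam); linarith
  simp only [tailBound]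
  split_ifs with h0 h1
  · -- `h = 0`
    refine h78.trans ?_
    rw [div_le_div_iff₀ (by positivity) (by positivity)]
    have : 0 ≤ |(h : ℝ) - q * lam| := abs_nonneg _
    nlinarith
  · -- `1 ≤ |h| ≤ 37q`
    have hh1 : (1 : ℝ) ≤ |(h : ℝ)| := by
      have : (1 : ℤ) ≤ |h| := Int.one_le_abs h0
      have := (Int.cast_le (R := ℝ)).2 this
      push_cast at this; exact this
    have hpos : 0 < |(h : ℝ) - q * lam| := by linarith
    refine h78.trans ?_
    rw [div_le_div_iff₀ (by positivity) (by positivity)]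
    nlinarith [hH₀]
  · -- `|h| > 37q`: Lemma 7.9
    rw [not_le] at h1
    have hh1 : (37 * q : ℝ) + 1 ≤ |(h : ℝ)| := by
      have h1' : ((37 * q : ℤ) : ℝ) < ((|h| : ℤ) : ℝ) := by push_cast; exact h1
      have h2 : (37 * q : ℤ) + 1 ≤ |h| := Int.cast_lt.1 h1'
      have := (Int.cast_le (R := ℝ)).2 h2
      push_cast at this; exact this
    have hq1 : (1 : ℝ) ≤ q := by exact_mod_cast Nat.pos_of_ne_zero (NeZero.ne q)
    have hup : 4 * μ * q * (N₁ + s + 1) ^ 2 ≤ 36 * q := by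
      have : (N₁ + s + 1) ^ 2 ≤ 9 * (N + s) ^ 2 := by
        have h0 : 0 ≤ N₁ + s + 1 := by linarith
        have h3 : N₁ + s + 1 ≤ 3 * (N + s) := by linarith
        nlinarith [pow_le_pow_left₀ h0 h3 2]
      calc 4 * μ * q * (N₁ + s + 1) ^ 2 ≤ 4 * μ * q * (9 * (N + s) ^ 2) := by gcongr
        _ = 36 * q * (μ * (N + s) ^ 2) := by ring
        _ ≤ 36 * q * 1 := by gcongr
        _ = 36 * q := by ring
    have hfar : 4 * μ * q * (N₁ + s + 1) ^ 2 ≤ |(h : ℝ) - q * lam| := by linarith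
    refine (norm_poissonInt_neg_le_of_far hμ hN' hNN₁ hN₁' h hfar).trans ?_
    have hd : 0 < (|(h : ℝ)| - 1) * |(h : ℝ)| := by nlinarith
    have htpos : 0 < |(h : ℝ)| - 1 / 2 := by linarith
    have hsq : ((|(h : ℝ)| - 1) * |(h : ℝ)|) ≤ ((h : ℝ) - q * lam) ^ 2 := by
      calc (|(h : ℝ)| - 1) * |(h : ℝ)| ≤ (|(h : ℝ)| - 1 / 2) ^ 2 := by nlinarith
        _ ≤ |(h : ℝ) - q * lam| ^ 2 := pow_le_pow_left₀ htpos.le htil 2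
        _ = ((h : ℝ) - q * lam) ^ 2 := sq_abs _
    calc 100 * (1 + μ * (N + s) ^ 2) * q ^ 2 / ((h : ℝ) - q * lam) ^ 2
        ≤ 100 * (1 + 1) * q ^ 2 / ((|(h : ℝ)| - 1) * |(h : ℝ)|) := by
          gcongr
      _ = 200 * q ^ 2 / ((|(h : ℝ)| - 1) * |(h : ℝ)|) := by ring

omit [NeZero q] in
/-- **Summing the majorant:** `∑_{|h| ≤ L} β(h) ≤ 7/(μN'²) + 28q(5 + log q) + 11q`. [folklore] -/
theorem sum_tailBound_le {μ N' : ℝ} (hq : 1 ≤ q) (L : ℕ) :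
    ∑ h ∈ Finset.Icc (-(L : ℤ)) L, tailBound q μ N' h ≤
      7 / (μ * N' ^ 2) + 28 * q * (5 + Real.log q) + 11 * q := by
  have hqR : (1 : ℝ) ≤ q := by exact_mod_cast hq
  rw [sum_Icc_neg_eq]
  have h0 : tailBound q μ N' 0 = 7 / (μ * N' ^ 2) := by simp [tailBound]
  rw [h0]
  simp only [tailBound_neg, ← two_mul]
  rw [← Finset.mul_sum]
  -- the positive part
  have hpos : ∀ n ∈ Finset.Icc 1 L, tailBound q μ N' (n : ℤ) =
      if n ≤ 37 * q then 14 * q / (n : ℝ) else 200 * q ^ 2 / (((n : ℝ) - 1) * n) := by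
    intro n hn
    rw [Finset.mem_Icc] at hn
    have hn0 : (n : ℤ) ≠ 0 := by exact_mod_cast (by omega : n ≠ 0)
    have habs : |((n : ℤ) : ℝ)| = (n : ℝ) := by push_cast; exact abs_of_nonneg (Nat.cast_nonneg _)
    rw [tailBound, if_neg hn0, habs]
    by_cases hc : n ≤ 37 * q
    · rw [if_pos (by exact_mod_cast hc), if_pos hc]
    · rw [if_neg (by exact_mod_cast hc), if_neg hc]
  rw [Finset.sum_congr rfl hpos, Finset.sum_ite]
  have hA : ∑ n ∈ (Finset.Icc 1 L).filter (fun n => n ≤ 37 * q), 14 * q / (n : ℝ) ≤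
      14 * q * (1 + Real.log (37 * q : ℕ)) := by
    calc ∑ n ∈ (Finset.Icc 1 L).filter (fun n => n ≤ 37 * q), 14 * q / (n : ℝ)
        ≤ ∑ n ∈ Finset.Icc 1 (37 * q), 14 * q / (n : ℝ) := by
          refine Finset.sum_le_sum_of_subset_of_nonneg ?_ (fun n _ _ => by positivity)
          intro n hn
          simp only [Finset.mem_filter, Finset.mem_Icc] at hn ⊢
          omega
      _ = 14 * q * ∑ n ∈ Finset.Icc 1 (37 * q), 1 / (n : ℝ) := by
          rw [Finset.mul_sum]; refine Finset.sum_congr rfl fun n _ => ?_; ring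
      _ ≤ 14 * q * (1 + Real.log (37 * q : ℕ)) := by
          gcongr; exact sum_Icc_inv_le_log _
  have hB : ∑ n ∈ (Finset.Icc 1 L).filter (fun n => ¬ n ≤ 37 * q), 200 * q ^ 2 / (((n : ℝ) - 1) * n) ≤
      200 * (q : ℝ) ^ 2 * (1 / ((37 * q : ℕ) : ℝ)) := by
    calc ∑ n ∈ (Finset.Icc 1 L).filter (fun n => ¬ n ≤ 37 * q), 200 * q ^ 2 / (((n : ℝ) - 1) * n)
        ≤ ∑ n ∈ Finset.Icc (37 * q + 1) L, 200 * q ^ 2 / (((n : ℝ) - 1) * n) := by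
          refine Finset.sum_le_sum_of_subset_of_nonneg ?_ ?_
          · intro n hn
            simp only [Finset.mem_filter, Finset.mem_Icc] at hn ⊢
            omega
          · intro n hn _
            rw [Finset.mem_Icc] at hn
            have : (2 : ℝ) ≤ n := by exact_mod_cast (by omega : 2 ≤ n)
            apply div_nonneg (by positivity); nlinarith
      _ = 200 * q ^ 2 * ∑ n ∈ Finset.Icc (37 * q + 1) L, 1 / (((n : ℝ) - 1) * n) := by
          rw [Finset.mul_sum]; refine Finset.sum_congr rfl fun n _ => ?_; ring
      _ ≤ 200 * (q : ℝ) ^ 2 * (1 / ((37 * q : ℕ) : ℝ)) := by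
          gcongr; exact sum_Icc_inv_mul_le (by omega) L
  have hlog : Real.log (37 * q : ℕ) ≤ 4 + Real.log q := by
    push_cast
    rw [Real.log_mul (by norm_num) (by positivity)]
    linarith [log_37_le]
  have hB' : 200 * (q : ℝ) ^ 2 * (1 / ((37 * q : ℕ) : ℝ)) ≤ 11 / 2 * q := by
    push_cast
    rw [show 200 * (q : ℝ) ^ 2 * (1 / (37 * q)) = 200 / 37 * q by field_simp]
    nlinarith
  have hlq : 0 ≤ Real.log q := Real.log_nonneg hqR
  have hq0 : (0 : ℝ) ≤ q := by linarith
  nlinarith [hA, hB, hB', hlog, mul_le_mul_of_nonneg_left hlog (by positivity : (0 : ℝ) ≤ 14 * q)]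

/-! ### The structure theorem -/

/-- **Structure of the twisted cubic sum (generalising Graham–Kolesnik's Lemma 7.16): Gauss sums
times Airy–Hardy integrals.** Let `q ≥ 1`, `(a, q) = 1`, `μ > 0`, `1 ≤ N`, `N + 1 ≤ N₁`, and for the
shifted endpoints `N' = N + s`, `N₁' = N₁ + s` assume `1 ≤ N'`, `N₁' ≤ 2N'`, `μN'² ≤ 1`; let
`|qλ| ≤ 1/2`. Then
`S = ∑_{N<n≤N₁} e(μ(n+s)³ + λn) e((an²+bn)/q)`
`  = q⁻¹ ∑_{h ∈ W} G(a, b+h; q) e(ω_h s) J(μ, q; N', N₁'; h - qλ) + E`,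
`‖E‖ ≤ 2 + 11/(μN'²) + 227 q^{1/2} (1 + log q)`,
where `ω_h = (h - qλ)/q`, `J` is the trapezoid-weighted Airy–Hardy integral `airyTrap` on
`[N', N₁'+1]`, and `W = {h : 2μqN'² < h - qλ < 4μq(N₁'+1)²}` (`window`). For `s = λ = 0` this is the
decomposition in the proof of G–K's Lemma 7.16 ("the terms with `|h| ≥ 16c` contribute `≪ c^{1/2}`
by Lemma 7.9 … the terms with `1 ≤ |h| < 16c`, `h ∉ [2μcN², 4μcN₁²]` contribute `≪ c^{1/2} log N`
… the term `h = 0` contributes `≪ μ⁻¹N⁻²`"), with the window kept unevaluated; the shift `s` and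
the twist `λ` (completing the cube for a quadratic perturbation `βn²` and a real linear
coefficient) are what the Huxley–Watt arcs require.
[cite: GrahamKolesnik1991, Lemma 7.16 (proof)] -/
theorem cubicSum_structure {a : ℤ} (ha : IsUnit (a : ZMod q)) (b : ℤ) {μ s lam N N₁ : ℝ}
    (hμ : 0 < μ) (hN : 1 ≤ N) (hNN₁ : N + 1 ≤ N₁) (hN' : 1 ≤ N + s) (hN₁' : N₁ + s ≤ 2 * (N + s))
    (hμN : μ * (N + s) ^ 2 ≤ 1) (hlam : |q * lam| ≤ 1 / 2) :
    ‖cubicSum q a b μ s lam N N₁ -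
        (1 / (q : ℂ)) * ∑ h ∈ window q μ s lam N N₁,
          quadGaussSum q a ((b : ZMod q) + (h : ZMod q)) *
            (Complex.exp (2 * π * I * ((h - q * lam) / q * s : ℝ)) * airyTrap μ q (N + s) (N₁ + s) (h - q * lam))‖
      ≤ 2 + 11 / (μ * (N + s) ^ 2) + 227 * Real.sqrt q * (1 + Real.log q) := by
  classical
  have hq0 : (0 : ℝ) < q := by exact_mod_cast Nat.pos_of_ne_zero (NeZero.ne q)
  have hq1 : 1 ≤ q := Nat.pos_of_ne_zero (NeZero.ne q)
  have hq1R : (1 : ℝ) ≤ q := by exact_mod_cast hq1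
  have hlam1 : |lam| ≤ 1 := by
    rw [abs_mul, abs_of_pos hq0] at hlam
    have : |lam| * 1 ≤ |lam| * q := by gcongr
    linarith
  set S := cubicSum q a b μ s lam N N₁ with hSdef
  set Sg := cubicTrapSum q a b μ s lam N N₁ with hSgdef
  set G : ℤ → ℂ := fun h => quadGaussSum q a ((b : ZMod q) + (h : ZMod q)) with hGdef
  set W := window q μ s lam N N₁ with hWdef
  set MT := (1 / (q : ℂ)) * ∑ h ∈ W, G h * poissonInt q μ s lam N N₁ (-h) with hMTdef
  -- rewrite the main term with `poissonInt`
  have hMT : (1 / (q : ℂ)) * ∑ h ∈ W, quadGaussSum q a ((b : ZMod q) + (h : ZMod q)) *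
      (Complex.exp (2 * π * I * ((h - q * lam) / q * s : ℝ)) * airyTrap μ q (N + s) (N₁ + s) (h - q * lam))
      = MT := by
    simp only [hMTdef, hGdef, poissonInt_neg]
  rw [hMT]
  -- Step 1
  have h1 : ‖S - Sg‖ ≤ 2 := norm_cubicSum_sub_cubicTrapSum_le q a b μ s lam (by linarith) hNN₁
  -- the `V`-independent tail bound
  set CT : ℝ := (1 + 2 * π * (3 * μ * (N₁ + s + 1) ^ 2 + 2)) * (N₁ - N + 7) with hCT
  have hCT0 : 0 < CT := by
    have : 0 < N₁ - N + 7 := by linarith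
    positivity
  set B₄ : ℝ := Real.sqrt 2 / Real.sqrt q * (7 / (μ * (N + s) ^ 2) + 28 * q * (5 + Real.log q) + 11 * q)
    with hB₄
  -- Step 2–4 for each `V ≥ 38`
  have hV : ∀ V : ℕ, 38 ≤ V → ‖Sg - MT‖ ≤ Real.sqrt (2 * q) * (CT * sawEta V) + B₄ := by
    intro V hV38
    set EV := (1 / (q : ℂ)) * ∑ h ∈ Finset.Ioc (-(V : ℤ) * q - q) ((V : ℤ) * q),
      G h * poissonInt q μ s lam N N₁ (-h) with hEV
    have h2 : ‖Sg - EV‖ ≤ Real.sqrt (2 * q) * (CT * sawEta V) := by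
      have := norm_cubicTrapSum_sub_sum_poissonInt_le (s := s) (lam := lam) (N := N) (N₁ := N₁) ha b hμ.le
        (by linarith) hNN₁ (by linarith) hlam1 (by omega : 1 ≤ V)
      simp only [hSgdef, hEV, hGdef, hCT, mul_assoc] at this ⊢
      exact this
    -- `W ⊆ Ioc`
    have hWsub : W ⊆ Finset.Ioc (-(V : ℤ) * q - q) ((V : ℤ) * q) := by
      intro h hh
      obtain ⟨hlo, hhi⟩ := mem_window_bounds hμ hNN₁ hN' hN₁' hμN hlam hh
      rw [Finset.mem_Ioc]
      have hq' : (0 : ℤ) < q := by exact_mod_cast hq1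
      constructor <;> nlinarith
    have h3 : EV - MT = (1 / (q : ℂ)) * ∑ h ∈ Finset.Ioc (-(V : ℤ) * q - q) ((V : ℤ) * q) \ W,
        G h * poissonInt q μ s lam N N₁ (-h) := by
      rw [hEV, hMTdef, ← mul_sub, ← Finset.sum_sdiff hWsub, add_sub_cancel_right]
    have h4 : ‖EV - MT‖ ≤ B₄ := by
      rw [h3, norm_mul, norm_div, norm_one, Complex.norm_natCast]
      have hsum : ‖∑ h ∈ Finset.Ioc (-(V : ℤ) * q - q) ((V : ℤ) * q) \ W, G h * poissonInt q μ s lam N N₁ (-h)‖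
          ≤ Real.sqrt (2 * q) * ∑ h ∈ Finset.Ioc (-(V : ℤ) * q - q) ((V : ℤ) * q) \ W,
              tailBound q μ (N + s) h := by
        refine (norm_sum_le _ _).trans ?_
        rw [Finset.mul_sum]
        refine Finset.sum_le_sum fun h hh => ?_
        rw [Finset.mem_sdiff] at hh
        rw [norm_mul]
        exact mul_le_mul (norm_quadGaussSum_le_sqrt ha _)
          (norm_poissonInt_neg_le_tailBound hμ hN' hNN₁ hN₁' hμN hlam hh.2) (norm_nonneg _)
          (Real.sqrt_nonneg _)
      have htail : ∑ h ∈ Finset.Ioc (-(V : ℤ) * q - q) ((V : ℤ) * q) \ W, tailBound q μ (N + s) h ≤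
          7 / (μ * (N + s) ^ 2) + 28 * q * (5 + Real.log q) + 11 * q := by
        calc ∑ h ∈ Finset.Ioc (-(V : ℤ) * q - q) ((V : ℤ) * q) \ W, tailBound q μ (N + s) h
            ≤ ∑ h ∈ Finset.Icc (-((V * q + q : ℕ) : ℤ)) ((V * q + q : ℕ) : ℤ), tailBound q μ (N + s) h := by
              refine Finset.sum_le_sum_of_subset_of_nonneg ?_ (fun h _ _ => tailBound_nonneg hμ.le h)
              intro h hh
              rw [Finset.mem_sdiff, Finset.mem_Ioc] at hh
              rw [Finset.mem_Icc]
              push_cast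
              have hq' : (0 : ℤ) ≤ q := by positivity
              constructor <;> nlinarith [hh.1.1, hh.1.2]
          _ ≤ _ := sum_tailBound_le hq1 _
      have hsq : Real.sqrt (2 * q) = Real.sqrt 2 * Real.sqrt q := Real.sqrt_mul (by norm_num) _
      have hsq0 : 0 < Real.sqrt q := Real.sqrt_pos.2 hq0
      calc 1 / (q : ℝ) * ‖∑ h ∈ Finset.Ioc (-(V : ℤ) * q - q) ((V : ℤ) * q) \ W, G h * poissonInt q μ s lam N N₁ (-h)‖
          ≤ 1 / (q : ℝ) * (Real.sqrt (2 * q) * (7 / (μ * (N + s) ^ 2) + 28 * q * (5 + Real.log q) + 11 * q)) := by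
            gcongr
            exact hsum.trans (by gcongr)
        _ = B₄ := by
            rw [hB₄, hsq, show 1 / (q : ℝ) * (Real.sqrt 2 * Real.sqrt q *
                (7 / (μ * (N + s) ^ 2) + 28 * q * (5 + Real.log q) + 11 * q)) =
              Real.sqrt 2 * (Real.sqrt q / q) * (7 / (μ * (N + s) ^ 2) + 28 * q * (5 + Real.log q) + 11 * q)
              by ring, Real.sqrt_div_self']
            ring
    calc ‖Sg - MT‖ = ‖(Sg - EV) + (EV - MT)‖ := by congr 1; ring
      _ ≤ ‖Sg - EV‖ + ‖EV - MT‖ := norm_add_le _ _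
      _ ≤ _ := add_le_add h2 h4
  -- Step 5: let `V → ∞`
  have hlim : ‖Sg - MT‖ ≤ B₄ := by
    refine le_of_forall_pos_le_add fun ε hε => ?_
    have hK : 0 < Real.sqrt (2 * q) * CT + 1 := by positivity
    obtain ⟨V₀, _, hV₀⟩ := exists_sawEta_le (δ := ε / (Real.sqrt (2 * q) * CT + 1)) (by positivity)
    have hη := hV₀ (max V₀ 38) (le_max_left _ _)
    have := hV (max V₀ 38) (le_max_right _ _)
    have hb : Real.sqrt (2 * q) * (CT * sawEta (max V₀ 38)) ≤ ε := by
      calc Real.sqrt (2 * q) * (CT * sawEta (max V₀ 38))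
          = (Real.sqrt (2 * q) * CT) * sawEta (max V₀ 38) := by ring
        _ ≤ (Real.sqrt (2 * q) * CT + 1) * (ε / (Real.sqrt (2 * q) * CT + 1)) := by
            gcongr
            · exact sawEta_nonneg _
            · linarith
        _ = ε := by field_simp
    linarith
  -- constants
  have hB₄le : B₄ ≤ 11 / (μ * (N + s) ^ 2) + 227 * Real.sqrt q * (1 + Real.log q) := by
    rw [hB₄]
    have hs2 : Real.sqrt 2 ≤ 3 / 2 := by
      rw [Real.sqrt_le_left (by norm_num)]; norm_num
    have hsq0 : 0 < Real.sqrt q := Real.sqrt_pos.2 hq0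
    have hsq1 : 1 ≤ Real.sqrt q := by rw [Real.le_sqrt (by norm_num) hq0.le]; simpa using hq1R
    have hqq : (q : ℝ) = Real.sqrt q * Real.sqrt q := (Real.mul_self_sqrt hq0.le).symm
    have hlq : 0 ≤ Real.log q := Real.log_nonneg hq1R
    have hμN' : 0 < μ * (N + s) ^ 2 := by positivity
    -- split `B₄` into the two terms
    set A : ℝ := 7 / (μ * (N + s) ^ 2) with hA
    set K : ℝ := 28 * (5 + Real.log q) + 11 with hK
    have hA0 : 0 ≤ A := by positivity
    have hK0 : 0 ≤ K := by rw [hK]; positivity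
    have e0 : (7 / (μ * (N + s) ^ 2) + 28 * q * (5 + Real.log q) + 11 * q : ℝ) = A + q * K := by
      rw [hA, hK]; ring
    rw [e0, mul_add]
    have hc1 : Real.sqrt 2 / Real.sqrt q ≤ 3 / 2 := by
      calc Real.sqrt 2 / Real.sqrt q ≤ Real.sqrt 2 := div_le_self (Real.sqrt_nonneg _) hsq1
        _ ≤ 3 / 2 := hs2
    have t1 : Real.sqrt 2 / Real.sqrt q * A ≤ 3 / 2 * A := by gcongr
    have e2 : Real.sqrt 2 / Real.sqrt q * (q * K) = Real.sqrt 2 * Real.sqrt q * K := by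
      rw [div_mul_eq_mul_div, div_eq_iff hsq0.ne']
      rw [show Real.sqrt 2 * Real.sqrt q * K * Real.sqrt q = Real.sqrt 2 * K * (Real.sqrt q * Real.sqrt q) by ring,
        Real.mul_self_sqrt hq0.le]
      ring
    have t2 : Real.sqrt 2 * Real.sqrt q * K ≤ 3 / 2 * Real.sqrt q * K := by gcongr
    have t3 : 3 / 2 * Real.sqrt q * K ≤ 227 * Real.sqrt q * (1 + Real.log q) := by
      rw [hK]; nlinarith [mul_nonneg hsq0.le hlq]
    have t4 : 3 / 2 * A ≤ 11 / (μ * (N + s) ^ 2) := by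
      rw [hA, show (3 : ℝ) / 2 * (7 / (μ * (N + s) ^ 2)) = (21 / 2) / (μ * (N + s) ^ 2) by ring]
      exact div_le_div_of_nonneg_right (by norm_num) hμN'.le
    rw [e2]
    linarith
  calc ‖S - MT‖ = ‖(S - Sg) + (Sg - MT)‖ := by congr 1; ring
    _ ≤ ‖S - Sg‖ + ‖Sg - MT‖ := norm_add_le _ _
    _ ≤ 2 + B₄ := add_le_add h1 hlim
    _ ≤ _ := by linarith

end Tails

end CubicSum
end Literature.NumberTheory.LFunctions
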